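import Summits.BirchSwinnertonDyer.Rank1Residual.Additive.QuadraticBranchPlusKatoDivisibility
import Literature.NumberTheory.EllipticCurves.IwasawaAlgebraInvolution
import HarnessLib

/-!
# The KATO HALF of (C1_η) on the quadratic branch in PRINT-EXACT form for the tree's duals —
# (RK⁺)^ι: `Char X⁺(V/ℚ_∞) · (ι L_p⁺(V,η,X)) ⊆ Char X⁺(V/F_∞)`, `ι` the Iwasawa involution — and the
# FE-FREE consumer `(RK⁺)^ι ∧ onto ∧ (E⁺) ⟹ (C1_η)` (cell `bsd-potss`, seat `bsd-potss-k8q-c2x` g10;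
# K8 route `QuadraticBranchSignedControl`, planner ruling T-Q73ι-2 «K8-IOTA», duty of crux 20445's re-key)

HONEST FRAMING (cell `bsd-potss`, run/shared/lean/pub/bsd-potss/; FULL-BSD rank ≤ 1 programme,
tranche 1b, HUMAN RULING D-0036; verbatim in every file): the target of record is FULL BSD for every
analytic-rank ≤ 1 curve over `ℚ`; this cell attacks rows B4/B5/B8 (additive potentially
supersingular primes). THIS FILE types ONE statement as a `@[conjecture] def` — the sibling reading
(RK⁺) `QuadraticBranchPlusKatoDivisibilityAt` (Kobayashi 2003 Thm. 2.2 + Thm. 4.1, sign `+`,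
component `η`, THEOREM IN PRINT) with the branch function `Lη` replaced by its image `ι Lη` under the
Iwasawa involution `ι : T ↦ (1+T)⁻¹ − 1` (`IwasawaAlgebra.invol p`) in clauses (b) and (c) — and
PROVES, by pure algebra in the UFD `Λ = ℤ_p⟦T⟧`, that this `ι`-twisted Kato half together with the
OPEN Eisenstein half (E⁺) `QuadraticBranchPlusLowerInclusionAt` gives the crux node (C1_η)
`QuadraticBranchPlusMainConjectureAt` on the surjective-image locus, WITHOUT any functional equation of
`L_p⁺(V, η, X)`. TYPED INPUT + bookkeeping; nothing asserted; no named Literature fact minted; no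
`sorry`, axioms standard; (C1_η) stays a CONJECTURE IN PRINT, OPEN for non-CM `V`; the class served
(Gss2 = O5 ∩ `e = 2`, `p ≥ 5`) stays OPEN; nothing is booked. This is not "finishing BSD".

## Why the `ι` (the audit finding this file answers)

The tree's Pontryagin-dual data (`Kobayashi2003.SignedSelmerDualData V κ γ ε`, field `toDual_T_smul`:
"`(T·x)(s) = x(conj_γ s) − x(s)`") let `T = γ − 1` act on `X = Hom(Sel, ℚ_p/ℤ_p)` by PRE-composition
with `conj_γ`, i.e. by the contragredient action of `γ⁻¹`; print (Kobayashi Def. 2.1 with Kato §12.2 /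
(17.13.1): Poitou–Tate duality is `Λ`-linear for the contragredient structure) has `γ` acting by
`x ↦ x ∘ conj_{γ⁻¹}`. So the tree's `D.X` over `γ` is print's `X` twisted by `ι` (Greenberg's `X^ι`,
Adv. Stud. Pure Math. 17 pp. 101–102), `char_Λ(D.X) = ι(char_print)`, and Kobayashi's printed
Thm. 4.1 at `η` — `Char X⁺(V/K_∞)^η ⊇ (L_p⁺(V, η, X))` for the contragredient dual — reads, on the
tree's duals over the pinned generator `γ` (`χ(γ) = 1 + p`, `IsCyclotomicVariable p γ`), as
**`Char_Λ(D.X-part at η) ∋ ι L_p⁺(V, η, X)`**: statement (RK⁺)^ι below (bsd-cited audit, RELAY 46/51,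
rulings (647)/(660); kernel: seat k8q-c2x g9, `Theorems/QuadraticBranchSignedControlPlusKatoDivisibility
BranchOntoOfNamedFactsContra.lean`, p607149 — the literal (RK⁺) from the print-exact inputs costs an
UNPRINTED `ι`-symmetry of the fine local lengths). The literal sibling (RK⁺) = (RK⁺)^ι + the functional
equation `(ι L_p⁺(V,η,X)) = (L_p⁺(V,η,X))` of the branch function (Sprung 2017 Cor. 4.14 at the
character `ω^{(p−1)/2}`; not in the tree). (RK⁺)^ι is a kernel consequence of the three PRINT-EXACT
named facts `Kobayashi2003.thm62_63_73_etaColemanPoitouTate_zeta_contra` (p608027),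
`Kato2004.thm13_4_lengthAt_fineSelmerDualContra_le_of_isEulerSystemClass` (p600084),
`Kobayashi2003.thm12_signedSelmerDual_finite_torsion` on the tower-onto rows (producer: a Theorems
module of this seat; NOT this file).

## Why no functional equation is needed downstream (§2–§3)

The K8 consumer wants (C1_η) `Char X⁺(V/F_∞) = Char X⁺(V/ℚ_∞) · (Lη)`, assembled from an upper and a
lower inclusion. With the upper inclusion in the form (RK⁺)^ι — `(d)·(ι L) ⊆ (a)` — and the lower
(E⁺) — `(a) ⊆ (d)·(L)` — one has `a = d·L·c` and `d·ιL = a·e = d·L·c·e`; if `d = 0` or `L = 0` both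
sides are `0`; else `ιL = L·c·e`, and applying the INVOLUTION `ι` (`ι² = id`) gives
`L = ιL·ι(c e) = L·(c e ι(c e))`, so `c e ι(c e) = 1`, `c` is a unit and `(a) = (d·L)`. Hence
(RK⁺)^ι ∧ (E⁺) ⟹ (C1_η) — and, for free, the functional equation `(ι L) = (L)` AS A CONSEQUENCE on
that locus, never as an input. Every characteristic ideal over `Λ` is principal
(`charIdeal_isPrincipal_holds`), so the lemma applies to `A = Char X⁺(V/F_∞)`, `D₀ = Char X⁺(V/ℚ_∞)`.

## Contents

* §1 (RK⁺)^ι `QuadraticBranchPlusKatoDivisibilityIotaAt V p` — the sibling (RK⁺) VERBATIM (same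
  binders, same order) with `Ideal.span {Lη}` ↦ `Ideal.span {IwasawaAlgebra.invol p Lη}` in (b), (c).
* §2 algebra, PROVED: `associated_mul_of_mul_dvd_of_dvd_mul_invol` (`d·L ∣ a`, `a ∣ d·σL`, `σ² = id`
  ⟹ `d·L ~ a`, any commutative domain, no non-vanishing hypotheses) and its ideal form
  `ideal_eq_mul_span_singleton_of_le_of_mul_span_invol_le` (principal `A`, `D₀`).
* §3 bookkeeping, PROVED: `QuadraticBranchPlusKatoDivisibilityIotaAt.integral` (clause (c) on the
  onto locus) and **`quadraticBranchPlusMainConjectureAt_of_katoDivisibilityIota_of_lowerInclusion`**: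
  (RK⁺)^ι ∧ `ρ_{V,p^∞}` onto ∧ (E⁺) ⟹ (C1_η), FE-free; `…_iff_lowerInclusion_…`; and the by-product
  `mul_span_invol_le_mul_span_of_katoDivisibilityIota_of_lowerInclusion`
  (`Char X⁺(V/ℚ_∞)·(ι Lη) ⊆ Char X⁺(V/ℚ_∞)·(Lη)` on that locus: the functional equation of the ideal
  `(Lη)` is an OUTPUT there, never an input).

References: [Kobayashi2003] Thm. 2.2 (p. 5), §4 Even main conjecture + Thm. 4.1 (p. 8), Def. 2.1
(p. 5), Thm. 7.3 (7.21) and proof of Thm. 7.4 (p. 13) — corpus `paper:doi-10-1007-s00222-002-0265-4`;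
[Kato2004Asterisque] §12.2 (p. 220), Thm. 13.4 (p. 226), §17.13; [Greenberg1989] pp. 101–102 (`S^ι`);
[GreenbergLNM1716] §1 (p. 60), §3; [MazurTateTeitelbaum1986Invent] §I.17 (the involution);
[Washington1997] §13.2 (Λ a UFD, characteristic ideals principal); [Sprung2017] Cor. 4.14 (the
functional equation NOT used here).
-/

noncomputable section

open scoped Classical MatrixGroups ModularForm

open CongruenceSubgroup WeierstrassCurve Literature.NumberTheory.EllipticCurves
  Literature.NumberTheory.EllipticCurves.ModularForms
  Literature.NumberTheory.EllipticCurves.Kobayashi2003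
  Literature.NumberTheory.EllipticCurves.Rank1Residual
  Literature.NumberTheory.GaloisRepresentations ZpExtension

namespace Summit.BirchSwinnertonDyer.Rank1Residual.Additive

/-! ## §1 (RK⁺)^ι — Kobayashi Thm. 2.2 + Thm. 4.1, sign `+`, component `η`, read over `ℚ(√p*)` on the
tree's (pre-composition) duals: the branch function enters through `ι L_p⁺(V, η, X)` -/

/-- **TYPED INPUT (RK⁺)^ι — the PRINT-EXACT reading, on the tree's dual data, of Kobayashi 2003
Thm. 2.2 + Thm. 4.1 (sign `+`, component `η = ω^{(p−1)/2}`), THEOREMS IN PRINT, in the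
`ℚ(√p*)`-subtower currency of (C1_η); flags `Kob03-Thm41-eta-quadratic-subtower`,
`Kob03-Lplus-eta-upto-unit`, `Kob03-721-dual-action`; NOTHING asserted.** Verbatim (Invent. Math. 152,
p. 8): "By Theorem 2.2, `X^±(E/K_∞)^η` is a torsion `ℤ_p[[Γ]]`-module. […] **Theorem 4.1.** There
exists an integer `n ≥ 0` such that `Char(X⁺(E/K_∞)^η) ⊇ (pⁿ L_p⁺(E, η, X))` […] If the `p`-adic
representation `Gal(ℚ̄/ℚ) → GL_{ℤ_p}(T)` is surjective, then we can take `n = 0`." — where "`X`" is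
the Pontryagin dual with its CONTRAGREDIENT `Λ`-structure (Def. 2.1; (7.21) is `Λ`-linear for it, Kato
§12.2 / (17.13.1)). Binders = those of the sibling `QuadraticBranchPlusKatoDivisibilityAt V p` and of
`QuadraticBranchPlusMainConjectureAt V p`, word for word (`p` odd, `V` globally minimal with good
reduction at `p` and `a_p(V) = 0`; `F` quadratic with `θ² = p*`; `V'` an `F`-model of `V_F`; `κ`/`κF`
cyclotomic with generators `γ`/`γF` matching the variable `1 + p`; `f` the newform of `V`, `ϖ` the
period ratio of the parity of `η`, `Lη` ANY function with the interpolation property of `L_p⁺(V, η, X)`;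
`D`, `DF` ANY dual data of `Sel⁺(V/ℚ_∞)`, `Sel⁺(V/F_∞)` IN THE TREE'S CONVENTION — `T = γ − 1` acting by
pre-composition with `conj_γ`, which is print's dual twisted by the involution `ι`, Greenberg's `X^ι`).
Conclusion, read through `X⁺(V/F_∞) ≅ X⁺(V/ℚ_∞) ⊕ X⁺(V/K_∞)^η` and `char(X^ι) = ι(char X)`:
(a) `X⁺(V/F_∞)` is finitely generated `Λ`-torsion [Thm. 2.2 at `1` and `η`; `ι`-invariant];
(b) `pⁿ · Char X⁺(V/ℚ_∞) · (ι Lη) ⊆ Char X⁺(V/F_∞)` for some `n ≥ 0` [Thm. 4.1, first display, at `η`,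
transported by `ι`; `ι` fixes `p`]; (c) if `ρ_{V,p^∞}` is onto, `Char X⁺(V/ℚ_∞) · (ι Lη) ⊆ Char X⁺(V/F_∞)`
[its last sentence]. This is EXACTLY what print gives on the tree's duals; the sibling (RK⁺) (same
clauses with `Lη`) is this statement plus the functional equation `(ι L_p⁺(V,η,X)) = (L_p⁺(V,η,X))`
(Sprung 2017 Cor. 4.14 at `ω^{(p−1)/2}`), which is NOT needed downstream (§3). STATUS: theorem in print
(Kato side of the even main conjecture), typed as a reading because the prime-to-`p` descent
`K_∞ ⊋ F_∞` and the `⊕`-multiplicativity of `Char` are not formalised in the tree; on the tower-onto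
rows it is a kernel consequence of three print-exact named facts (producer module of seat k8q-c2x).
[cite: Kobayashi2003, Thm. 4.1 (p. 8) and Thm. 2.2 (p. 5); Def. 2.1 (p. 5), §3 (p. 5), Thm. 3.2 and (3.4)–(3.6) (p. 7), Thm. 7.3 i) (7.21) and proof of Thm. 7.4 (p. 13); corpus `paper:doi-10-1007-s00222-002-0265-4` p0005, p0008, p0013]
[cite: Kato2004Asterisque, §12.2 (p. 220), Thm. 12.5 and Thm. 13.4 (p. 226), §17.13 (17.13.1) (p. 279)]
[cite: Greenberg1989, pp. 101–102 (the Λ-module S^ι)] [cite: GreenbergLNM1716, §1 (p. 60) and §3 (descent; reading)]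
[cite: MazurTateTeitelbaum1986Invent, §I.17 (the involution ι)] -/
@[conjecture] def QuadraticBranchPlusKatoDivisibilityIotaAt (V : WeierstrassCurve ℚ) [V.IsElliptic]
    [V.IsGloballyMinimal] (p : ℕ) [Fact p.Prime] : Prop :=
  ∀ (F : Type) [Field F] [NumberField F] (V' : WeierstrassCurve F) [V'.IsElliptic]
    {κ : ZpExtension ℚ p} {γ : Field.absoluteGaloisGroup ℚ}
    {κF : ZpExtension F p} {γF : Field.absoluteGaloisGroup F}
    {N : ℕ} [NeZero N] {f : CuspForm (Gamma0 N) 2},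
    p ≠ 2 → V.HasGoodReductionAtPrime p → V.frobeniusTrace p = 0 →
    Module.finrank ℚ F = 2 → (∃ θ : F, θ ^ 2 = algebraMap ℚ F ((-1) ^ (p / 2) * p)) →
    (∃ C : VariableChange F, C • V.baseChange F = V') →
    κ.IsCyclotomic → κ.IsTopGenerator γ → IsCyclotomicVariable p γ →
    κF.IsCyclotomic → κF.IsTopGenerator γF →
    (∃ ζ : ℤ_[p]ˣ, IsOfFinOrder ζ ∧
      ((GaloisRep.cyclotomicCharacter F p γF * ζ : ℤ_[p]ˣ) : ℤ_[p]) =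
        (cyclotomicGenerator p : ℤ_[p])) →
    IsNewformOf V f →
    ∀ (ϖ : ℚ), (if Even (p / 2) then (ϖ : ℝ) * V.realPeriodRat = plusPeriod f
        else (ϖ : ℝ) * V.imaginaryPeriodRat = minusPeriod f) →
    ∀ (Lη : IwasawaAlgebra p), IsQuadraticBranchPlusLFunction f p ϖ Lη →
    ∀ (D : SignedSelmerDualData V κ γ 1) (DF : SignedSelmerDualData V' κF γF 1),
      Module.Finite (IwasawaAlgebra p) DF.X ∧ Module.IsTorsion (IwasawaAlgebra p) DF.X ∧
        (∃ n : ℕ, Ideal.span {(p : IwasawaAlgebra p) ^ n} *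
            (D.charIdeal * Ideal.span {IwasawaAlgebra.invol p Lη}) ≤ DF.charIdeal) ∧
        ((∀ m : ℕ, V.HasSurjectiveModNGaloisRep (p ^ m : ℕ)) →
          D.charIdeal * Ideal.span {IwasawaAlgebra.invol p Lη} ≤ DF.charIdeal)

/-! ## §2 The algebra: `d·L ∣ a ∣ d·σL` with `σ` an involution forces `a ~ d·L` -/

section Algebra

variable {R : Type*} [CommRing R] [IsDomain R] (σ : R →+* R)

/-- **The cancellation `c · e · σ(c e) = 1`.** In a commutative domain with a ring endomorphism `σ`
satisfying `σ ∘ σ = id`: if `d·L ∣ a` and `a ∣ d·σ(L)` then `d·L` and `a` are associated (no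
non-vanishing hypothesis: if `d = 0` or `L = 0` both are `0`). Proof: `a = dLc`, `d σL = a e = dLce`;
cancel `d`, apply `σ`, cancel `L`. [folklore] -/
theorem associated_mul_of_mul_dvd_of_dvd_mul_invol (hσ : ∀ x, σ (σ x) = x) {a d L : R}
    (h₁ : d * L ∣ a) (h₂ : a ∣ d * σ L) : Associated (d * L) a := by
  obtain ⟨c, rfl⟩ := h₁
  obtain ⟨e, he⟩ := h₂
  by_cases hd : d = 0
  · subst hd
    simp
  by_cases hL : L = 0
  · subst hL
    simp
  -- `σ L = L * (c * e)`
  have h3 : σ L = L * (c * e) := mul_left_cancel₀ hd (by rw [he]; ring)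
  -- apply `σ`: `L = σ L * σ (c * e) = L * (c * e * σ (c * e))`
  have h4 : L = L * (c * e * σ (c * e)) := by
    conv_lhs => rw [← hσ L, h3, map_mul, h3]
    ring
  have h5 : c * e * σ (c * e) = 1 := by
    have h6 : L * (c * e * σ (c * e)) = L * 1 := by rw [mul_one]; exact h4.symm
    exact mul_left_cancel₀ hL h6
  have hc : IsUnit c := IsUnit.of_mul_eq_one (e * σ (c * e)) (by rw [← h5]; ring)
  exact associated_mul_unit_right (d * L) c hc

/-- **Ideal form.** For principal ideals `A`, `D₀` of a commutative domain with an involutive ring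
endomorphism `σ` and any `L`: `A ⊆ D₀·(L)` and `D₀·(σ L) ⊆ A` force `A = D₀·(L)`. (Over `Λ = ℤ_p⟦T⟧`
every characteristic ideal is principal — `charIdeal_isPrincipal_holds`.) [folklore] -/
theorem ideal_eq_mul_span_singleton_of_le_of_mul_span_invol_le (hσ : ∀ x, σ (σ x) = x)
    {A D₀ : Ideal R} (hA : A.IsPrincipal) (hD : D₀.IsPrincipal) (L : R)
    (h₁ : A ≤ D₀ * Ideal.span {L}) (h₂ : D₀ * Ideal.span {σ L} ≤ A) :
    A = D₀ * Ideal.span {L} := by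
  obtain ⟨a, rfl⟩ := hA.principal
  obtain ⟨d, rfl⟩ := hD.principal
  change Ideal.span {a} = Ideal.span {d} * Ideal.span {L}
  change Ideal.span {a} ≤ Ideal.span {d} * Ideal.span {L} at h₁
  change Ideal.span {d} * Ideal.span {σ L} ≤ Ideal.span {a} at h₂
  rw [Ideal.span_singleton_mul_span_singleton, Ideal.span_singleton_le_span_singleton] at h₁ h₂
  rw [Ideal.span_singleton_mul_span_singleton, Ideal.span_singleton_eq_span_singleton]
  exact (associated_mul_of_mul_dvd_of_dvd_mul_invol σ hσ h₁ h₂).symm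

end Algebra

/-! ## §3 Bookkeeping: `(RK⁺)^ι ∧ onto ∧ (E⁺) ⟹ (C1_η)`, no functional equation -/

section Bookkeeping

variable {V : WeierstrassCurve ℚ} [V.IsElliptic] [V.IsGloballyMinimal] {p : ℕ} [Fact p.Prime]

/-- **The upper (Kato) inclusion in `ι`-form from the reading (RK⁺)^ι on the surjective-image locus**:
granted (RK⁺)^ι, if `ρ_{V,p^∞}` is onto then, on the binders of (C1_η), `X⁺(V/F_∞)` is finitely
generated `Λ`-torsion and `Char X⁺(V/ℚ_∞) · (ι Lη) ⊆ Char X⁺(V/F_∞)` — Thm. 4.1 with "`n = 0`", as a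
function of the reading. [cite: Kobayashi2003, Thm. 4.1 (p. 8), last sentence] -/
theorem QuadraticBranchPlusKatoDivisibilityIotaAt.integral
    (hK : QuadraticBranchPlusKatoDivisibilityIotaAt V p)
    (hsurj : ∀ m : ℕ, V.HasSurjectiveModNGaloisRep (p ^ m : ℕ))
    (F : Type) [Field F] [NumberField F] (V' : WeierstrassCurve F) [V'.IsElliptic]
    {κ : ZpExtension ℚ p} {γ : Field.absoluteGaloisGroup ℚ}
    {κF : ZpExtension F p} {γF : Field.absoluteGaloisGroup F}
    {N : ℕ} [NeZero N] {f : CuspForm (Gamma0 N) 2}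
    (hp : p ≠ 2) (hgood : V.HasGoodReductionAtPrime p) (hap : V.frobeniusTrace p = 0)
    (hF : Module.finrank ℚ F = 2) (hθ : ∃ θ : F, θ ^ 2 = algebraMap ℚ F ((-1) ^ (p / 2) * p))
    (hC : ∃ C : VariableChange F, C • V.baseChange F = V')
    (hκ : κ.IsCyclotomic) (hγ : κ.IsTopGenerator γ) (hγc : IsCyclotomicVariable p γ)
    (hκF : κF.IsCyclotomic) (hγF : κF.IsTopGenerator γF)
    (hζ : ∃ ζ : ℤ_[p]ˣ, IsOfFinOrder ζ ∧
      ((GaloisRep.cyclotomicCharacter F p γF * ζ : ℤ_[p]ˣ) : ℤ_[p]) =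
        (cyclotomicGenerator p : ℤ_[p]))
    (hf : IsNewformOf V f) (ϖ : ℚ)
    (hϖ : if Even (p / 2) then (ϖ : ℝ) * V.realPeriodRat = plusPeriod f
        else (ϖ : ℝ) * V.imaginaryPeriodRat = minusPeriod f)
    (Lη : IwasawaAlgebra p) (hL : IsQuadraticBranchPlusLFunction f p ϖ Lη)
    (D : SignedSelmerDualData V κ γ 1) (DF : SignedSelmerDualData V' κF γF 1) :
    Module.Finite (IwasawaAlgebra p) DF.X ∧ Module.IsTorsion (IwasawaAlgebra p) DF.X ∧
      D.charIdeal * Ideal.span {IwasawaAlgebra.invol p Lη} ≤ DF.charIdeal := by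
  obtain ⟨hfin, htor, -, hint⟩ :=
    hK F V' hp hgood hap hF hθ hC hκ hγ hγc hκF hγF hζ hf ϖ hϖ Lη hL D DF
  exact ⟨hfin, htor, hint hsurj⟩

/-- **(RK⁺)^ι ∧ `ρ_{V,p^∞}` onto ∧ (E⁺) ⟹ (C1_η), FE-FREE.** Granted the print-exact reading (RK⁺)^ι
of Kobayashi's Thm. 2.2 + 4.1 at `η` on the tree's duals and surjectivity of the `p`-adic
representation of `V`, the OPEN Eisenstein inclusion (E⁺) is ALL that separates the tree from (C1_η)
`QuadraticBranchPlusMainConjectureAt V p`: finite generation and torsion are clause (a), the upper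
inclusion `Char X⁺(V/ℚ_∞)·(ι Lη) ⊆ Char X⁺(V/F_∞)` is clause (c), the lower `Char X⁺(V/F_∞) ⊆
Char X⁺(V/ℚ_∞)·(Lη)` is (E⁺), and §2 (`ideal_eq_mul_span_singleton_of_le_of_mul_span_invol_le` with
`σ = ι`, `ι² = id`, both characteristic ideals principal) turns the two into the EQUALITY
`Char X⁺(V/F_∞) = Char X⁺(V/ℚ_∞)·(Lη)` — no functional equation of `L_p⁺(V, η, X)` is used. Binder
order `(hK) (hsurj) (hE)` as consumed by the route's `closes`. CONDITIONAL on both typed inputs; closes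
nothing by itself. [cite: Kobayashi2003, Thm. 2.2 (p. 5), Thm. 4.1 and §4 Even main conjecture (p. 8)]
[cite: Washington1997, §13.2 (characteristic ideals of Λ-modules are principal)] -/
theorem quadraticBranchPlusMainConjectureAt_of_katoDivisibilityIota_of_lowerInclusion
    (hK : QuadraticBranchPlusKatoDivisibilityIotaAt V p)
    (hsurj : ∀ m : ℕ, V.HasSurjectiveModNGaloisRep (p ^ m : ℕ))
    (hE : QuadraticBranchPlusLowerInclusionAt V p) : QuadraticBranchPlusMainConjectureAt V p := by
  intro F _ _ V' _ κ γ κF γF N _ f hp hgood hap hF hθ hC hκ hγ hγc hκF hγF hζ hf ϖ hϖ Lη hL D DF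
  obtain ⟨hfin, htor, hup⟩ :=
    hK.integral hsurj F V' hp hgood hap hF hθ hC hκ hγ hγc hκF hγF hζ hf ϖ hϖ Lη hL D DF
  refine ⟨hfin, htor, ?_⟩
  exact ideal_eq_mul_span_singleton_of_le_of_mul_span_invol_le
    (IwasawaAlgebra.invol p : IwasawaAlgebra p →+* IwasawaAlgebra p)
    (fun x => IwasawaAlgebra.invol_invol p x)
    (charIdeal_isPrincipal_holds p DF.X) (charIdeal_isPrincipal_holds p D.X) Lη
    (hE F V' hp hgood hap hF hθ hC hκ hγ hγc hκF hγF hζ hf ϖ hϖ Lη hL D DF) hup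

/-- **On the surjective-image locus, (C1_η) ⟺ (E⁺) granted the reading (RK⁺)^ι.** The Kato half of
the crux is a theorem in print (in its `ι`-exact form); the crux IS its Eisenstein half there.
CONDITIONAL; nothing booked. [cite: Kobayashi2003, Thm. 4.1 and §4 Even main conjecture (p. 8)] -/
theorem quadraticBranchPlusMainConjectureAt_iff_lowerInclusion_of_katoDivisibilityIota
    (hK : QuadraticBranchPlusKatoDivisibilityIotaAt V p)
    (hsurj : ∀ m : ℕ, V.HasSurjectiveModNGaloisRep (p ^ m : ℕ)) :
    QuadraticBranchPlusMainConjectureAt V p ↔ QuadraticBranchPlusLowerInclusionAt V p :=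
  ⟨quadraticBranchPlusLowerInclusionAt_of_plusMainConjectureAt,
    quadraticBranchPlusMainConjectureAt_of_katoDivisibilityIota_of_lowerInclusion hK hsurj⟩

/-- **By-product: the functional equation of the IDEAL `Char X⁺(V/ℚ_∞)·(Lη)` under `ι` is a
CONSEQUENCE on that locus** — granted (RK⁺)^ι, onto and (E⁺), on the binders of (C1_η):
`Char X⁺(V/ℚ_∞)·(ι Lη) ⊆ Char X⁺(V/ℚ_∞)·(Lη)` (the two upper bounds of `Char X⁺(V/F_∞)` compared;
with `Char X⁺(V/ℚ_∞) ≠ 0` this is `Lη ∣ ι Lη`, hence `(ι Lη) = (Lη)` by `ι² = id`). Recorded to make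
explicit that no functional equation is an INPUT of §3. [folklore] -/
theorem mul_span_invol_le_mul_span_of_katoDivisibilityIota_of_lowerInclusion
    (hK : QuadraticBranchPlusKatoDivisibilityIotaAt V p)
    (hsurj : ∀ m : ℕ, V.HasSurjectiveModNGaloisRep (p ^ m : ℕ))
    (hE : QuadraticBranchPlusLowerInclusionAt V p)
    (F : Type) [Field F] [NumberField F] (V' : WeierstrassCurve F) [V'.IsElliptic]
    {κ : ZpExtension ℚ p} {γ : Field.absoluteGaloisGroup ℚ}
    {κF : ZpExtension F p} {γF : Field.absoluteGaloisGroup F}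
    {N : ℕ} [NeZero N] {f : CuspForm (Gamma0 N) 2}
    (hp : p ≠ 2) (hgood : V.HasGoodReductionAtPrime p) (hap : V.frobeniusTrace p = 0)
    (hF : Module.finrank ℚ F = 2) (hθ : ∃ θ : F, θ ^ 2 = algebraMap ℚ F ((-1) ^ (p / 2) * p))
    (hC : ∃ C : VariableChange F, C • V.baseChange F = V')
    (hκ : κ.IsCyclotomic) (hγ : κ.IsTopGenerator γ) (hγc : IsCyclotomicVariable p γ)
    (hκF : κF.IsCyclotomic) (hγF : κF.IsTopGenerator γF)
    (hζ : ∃ ζ : ℤ_[p]ˣ, IsOfFinOrder ζ ∧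
      ((GaloisRep.cyclotomicCharacter F p γF * ζ : ℤ_[p]ˣ) : ℤ_[p]) =
        (cyclotomicGenerator p : ℤ_[p]))
    (hf : IsNewformOf V f) (ϖ : ℚ)
    (hϖ : if Even (p / 2) then (ϖ : ℝ) * V.realPeriodRat = plusPeriod f
        else (ϖ : ℝ) * V.imaginaryPeriodRat = minusPeriod f)
    (Lη : IwasawaAlgebra p) (hL : IsQuadraticBranchPlusLFunction f p ϖ Lη)
    (D : SignedSelmerDualData V κ γ 1) (DF : SignedSelmerDualData V' κF γF 1) :
    D.charIdeal * Ideal.span {IwasawaAlgebra.invol p Lη} ≤ D.charIdeal * Ideal.span {Lη} := by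
  obtain ⟨-, -, hup⟩ :=
    hK.integral hsurj F V' hp hgood hap hF hθ hC hκ hγ hγc hκF hγF hζ hf ϖ hϖ Lη hL D DF
  exact hup.trans (hE F V' hp hgood hap hF hθ hC hκ hγ hγc hκF hγF hζ hf ϖ hϖ Lη hL D DF)

end Bookkeeping

end Summit.BirchSwinnertonDyer.Rank1Residual.Additive

end
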